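import Summits.RiemannHypothesis.RiemannHypothesis.Theses.WeilComb
import Summits.RiemannHypothesis.RiemannHypothesis.Theorems.CombShapePositivity.Negative.WeilCombCombShapePositivityLoadBearing
import Literature.NumberTheory.LFunctions.WeilCriterionConverse
import Literature.NumberTheory.LFunctions.WeilExplicitFormulaProofs
import Literature.NumberTheory.LFunctions.UniformWeilPositivityRH
import Literature.NumberTheory.LFunctions.WeilSmallSupportPositivity
import Literature.Analysis.Complex.BoundedPowerSums

/-!
# `WeilComb.CombShapeDetection` (item stmt-RiemannHypothesis-11230): fixed-shape comb positivity ⇒ uniform Weil positivity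

Support item of route `RiemannHypothesis/WeilComb`.  If every fixed-shape log-integer comb
`g(x) = Σ_{m ≤ M} a m · ε⁻¹ φ₀((x − log m)/ε)`, `φ₀(u) = expNegInvGlue (1 − u²)`, has
`0 ≤ Re W(g ⋆ g̃)` (the crux `CombShapePositivity`), then `WeilPositivityOn a` holds for every
`a > 0`.

Proof (Path A of the item, "two nodes suffice"; it is the in-tree converse half of Weil's
criterion, `Literature/NumberTheory/LFunctions/WeilCriterionConverse.lean`, rerun on the smaller
family of tests that the hypothesis provides):

* A two-node comb `φ_ε(· − log m₁) + c φ_ε(· − log m₂)` is the translate by `log m₁` of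
  `WeilConverse.translateMix φ_ε c (log m₂ − log m₁)`, and `Q = weilQuadratic` is translation
  invariant (`weilQuadratic_translate`); so the hypothesis gives `0 ≤ Re Q(φ_ε + c·(φ_ε)_x)` for
  every `x ∈ log ℚ_{>0}` and every `c` (`combShapeDetection_two_node_nonneg`).
* `Q(g)` is the absolutely convergent zero form `Σ_ρ m(ρ) ĝ(ρ) conj ĝ(1 − ρ̄)`
  (`explicit_formula_holds`, `WeilConverse.hasWeilZeroSide_zeroForm`, uniqueness of limits:
  `combShapeDetection_zeroForm_eq_weilQuadratic`), so the polarisation identity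
  `WeilConverse.zeroForm_translateMix` yields `‖B_φ(x)‖ ≤ Re Q(φ)` for the exponential series
  `B_φ = WeilConverse.expSum φ` at these `x` (`combShapeDetection_norm_expSum_le_of_translateMix`).
* `B_φ` is continuous (dominated convergence on compacts, `combShapeDetection_continuous_expSum`)
  and `log(⌈(n+1)eˣ⌉/(n+1)) → x`, so the bound holds for all real `x`
  (`combShapeDetection_le_of_forall_log_nat_sub`, `combShapeDetection_norm_expSum_le_of_nodes`).
* A bounded exponential series with locally finite exponents has no terms off the imaginary
  axis (`BoundedPowerSum.sum_fiber_eq_zero_of_exp_real`): `m(ρ) P_φ(ρ) = 0` whenever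
  `Re ρ ≠ 1/2` (`combShapeDetection_order_mul_pairCoeff_eq_zero`).
* For a zero of ordinate `γ` take `ε = 1/(1 + |γ|)`: on `|t| ≤ ε` one has `cos(γt) > 0`, so
  `Re φ̂_ε(σ + iγ) > 0` for all `σ` (`combShapeDetection_re_weilMellin_shapeBump_pos`), hence
  `P_φ(ρ) ≠ 0` and `m(ρ) ≥ 1`: every non-trivial zero has `Re ρ = 1/2`
  (`combShapeDetection_re_eq_one_half`), i.e. `RiemannHypothesis`
  (`riemannHypothesis_iff_strip_holds`), and uniform Weil positivity follows from
  `riemannHypothesis_iff_forall_weilPositivityOn`.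

References: E. Bombieri, *Remarks on Weil's quadratic functional in the theory of prime numbers
I*, Rend. Lincei (9) 11 (2000), §3 Thm. 1; A. Weil (1952).
-/

noncomputable section

-- `Summit.RiemannHypothesis.RiemannHypothesis.…` duplicates `RiemannHypothesis` BY DESIGN (D-0017, single-problem
-- summit); mirrors the Summits library option `weak.linter.dupNamespace = false` of `lakefile.toml`.
set_option linter.dupNamespace false

open scoped BigOperators ComplexConjugate ContDiff Real Topology
open Complex MeasureTheory Set Filter

namespace Summit.RiemannHypothesis.RiemannHypothesis.Theorems

open Literature.NumberTheory.LFunctions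
open Literature.NumberTheory.LFunctions.WeilConverse
open Summit.RiemannHypothesis.RiemannHypothesis.Theses.WeilComb

/-! ## Generic facts about the zero form of a Weil test -/

/-- For a Weil test `g` the zero form `Σ_ρ m(ρ) ĝ(ρ) conj ĝ(1 − ρ̄)` equals `Q(g) = W(g ⋆ g̃)`:
both are limits of the symmetric partial zero sums of `g ⋆ g̃` (`hasWeilZeroSide_zeroForm`,
`explicit_formula_holds`). [cite: Bombieri2000, Thm 2] -/
theorem combShapeDetection_zeroForm_eq_weilQuadratic {g : ℝ → ℂ} (hg : IsWeilTest g) :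
    zeroForm g = weilQuadratic g :=
  tendsto_nhds_unique (hasWeilZeroSide_zeroForm hg)
    (explicit_formula_holds (hg.weilConv hg.weilReflect))

/-- Polarisation at ONE shift `x`: if `Re Q(g) ≥ 0` and `Re Q(g + c·g(· − x)) ≥ 0` for every
`c : ℂ`, then `‖B_g(x)‖ ≤ Re Q(g)` (choose `c = −conj B_g(x)/‖B_g(x)‖` in
`zeroForm_translateMix`; the proof of `WeilConverse.norm_expSum_le` with its hypothesis
localised). [folklore] -/
theorem combShapeDetection_norm_expSum_le_of_translateMix {g : ℝ → ℂ} (hg : IsWeilTest g)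
    {x : ℝ} (hQ : 0 ≤ (zeroForm g).re)
    (hx : ∀ c : ℂ, 0 ≤ (zeroForm (translateMix g c x)).re) :
    ‖expSum g x‖ ≤ (zeroForm g).re := by
  set B := expSum g x with hBdef
  by_cases hB : B = 0
  · rw [hB, norm_zero]; exact hQ
  have hA : expSum' g x = conj B := by
    rw [hBdef, ← conj_expSum' g x, Complex.conj_conj]
  have hn0 : ‖B‖ ≠ 0 := norm_ne_zero_iff.2 hB
  have hn : (‖B‖ : ℂ) ≠ 0 := by exact_mod_cast hn0
  set c : ℂ := -conj B / (‖B‖ : ℂ) with hc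
  have hcB : c * B = -(‖B‖ : ℂ) := by
    rw [hc, div_mul_eq_mul_div, neg_mul, Complex.conj_mul', neg_div]
    congr 1
    rw [sq, mul_div_assoc, div_self hn, mul_one]
  have hc1 : Complex.normSq c = 1 := by
    rw [Complex.normSq_eq_norm_sq, hc, norm_div, norm_neg, Complex.norm_conj, Complex.norm_real,
      Real.norm_eq_abs, abs_norm, div_self hn0, one_pow]
  have h0 := hx c
  rw [zeroForm_translateMix hg c x, hA, ← map_mul, hcB, hc1] at h0
  simp only [map_neg, Complex.conj_ofReal, Complex.ofReal_one, one_mul, add_re, neg_re,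
    Complex.ofReal_re] at h0
  linarith

/-- The exponential series `B_g(x) = Σ_ρ m(ρ) P_g(ρ) e^{(ρ − 1/2)x}` of a Weil test is
continuous in `x`: on `|x − x₀| ≤ 1` its terms are dominated by `‖m(ρ) P_g(ρ)‖ e^{(|x₀|+1)/2}`,
which is summable (`summable_norm_pairCoeff`). [folklore] -/
theorem combShapeDetection_continuous_expSum {g : ℝ → ℂ} (hg : IsWeilTest g) :
    Continuous (expSum g) := by
  refine continuous_iff_continuousAt.2 fun x₀ ↦ ?_
  have hR : ContinuousOn (expSum g) (Icc (x₀ - 1) (x₀ + 1)) := by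
    refine continuousOn_tsum
      (f := fun (ρ : ZetaZeros.riemannZetaNontrivialZeros) (x : ℝ) ↦
        (riemannZetaZeroOrder (ρ : ℂ) : ℂ) * pairCoeff g ρ * cexp (((ρ : ℂ) - 1 / 2) * x))
      (u := fun ρ : ZetaZeros.riemannZetaNontrivialZeros ↦
        ‖(riemannZetaZeroOrder (ρ : ℂ) : ℂ) * pairCoeff g ρ‖ * Real.exp ((|x₀| + 1) / 2))
      (fun ρ ↦ ?_) ((summable_norm_pairCoeff hg).mul_right _) (fun ρ x hx ↦ ?_)
    · exact (continuous_const.mul (Complex.continuous_exp.comp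
        (continuous_const.mul Complex.continuous_ofReal))).continuousOn
    · rw [norm_mul]
      refine mul_le_mul_of_nonneg_left ?_ (norm_nonneg _)
      refine (norm_cexp_mul_real_le (abs_re_sub_half_le ρ.2) x).trans (Real.exp_le_exp.2 ?_)
      rw [mem_Icc] at hx
      have h1 : |x| ≤ |x₀| + 1 := abs_le.2 ⟨by linarith [neg_abs_le x₀], by linarith [le_abs_self x₀]⟩
      linarith
  exact hR.continuousAt (Icc_mem_nhds (by linarith) (by linarith))

/-- Density step: a continuous `f : ℝ → ℝ` with `f (log m₂ − log m₁) ≤ Q` for all positive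
naturals `m₁, m₂` satisfies `f ≤ Q` everywhere, since
`log ⌈(n+1)eˣ⌉ − log (n+1) → x`. [folklore] -/
theorem combShapeDetection_le_of_forall_log_nat_sub {f : ℝ → ℝ} (hf : Continuous f) {Q : ℝ}
    (h : ∀ m₁ m₂ : ℕ, 0 < m₁ → 0 < m₂ → f (Real.log m₂ - Real.log m₁) ≤ Q) (x : ℝ) :
    f x ≤ Q := by
  set N : ℕ → ℕ := fun n ↦ ⌈((n : ℝ) + 1) * Real.exp x⌉₊ with hN
  have hn1 : ∀ n : ℕ, (0 : ℝ) < (n : ℝ) + 1 := fun n ↦ by positivity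
  have hNpos : ∀ n : ℕ, 0 < N n := fun n ↦ Nat.ceil_pos.2 (by positivity)
  have hlow : ∀ n : ℕ, Real.exp x ≤ (N n : ℝ) / ((n : ℝ) + 1) := fun n ↦ by
    rw [le_div_iff₀ (hn1 n), mul_comm]
    exact Nat.le_ceil _
  have hupp : ∀ n : ℕ, (N n : ℝ) / ((n : ℝ) + 1) ≤ Real.exp x + 1 / ((n : ℝ) + 1) := fun n ↦ by
    rw [div_le_iff₀ (hn1 n), add_mul, one_div, inv_mul_cancel₀ (hn1 n).ne']
    calc (N n : ℝ) ≤ ((n : ℝ) + 1) * Real.exp x + 1 := (Nat.ceil_lt_add_one (by positivity)).le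
      _ = Real.exp x * ((n : ℝ) + 1) + 1 := by ring
  have hlim : Tendsto (fun n : ℕ ↦ Real.exp x + 1 / ((n : ℝ) + 1)) atTop (𝓝 (Real.exp x)) := by
    have h' := (tendsto_const_nhds (x := Real.exp x) (f := (atTop : Filter ℕ))).add
      (tendsto_one_div_add_atTop_nhds_zero_nat (𝕜 := ℝ))
    rwa [add_zero] at h'
  have hu : Tendsto (fun n : ℕ ↦ (N n : ℝ) / ((n : ℝ) + 1)) atTop (𝓝 (Real.exp x)) :=
    tendsto_of_tendsto_of_tendsto_of_le_of_le tendsto_const_nhds hlim hlow hupp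
  have hlog : Tendsto (fun n : ℕ ↦ Real.log ((N n : ℝ) / ((n : ℝ) + 1))) atTop (𝓝 x) := by
    have h' := (Real.continuousAt_log (Real.exp_pos x).ne').tendsto.comp hu
    rwa [Real.log_exp] at h'
  have hfx : Tendsto (fun n : ℕ ↦ f (Real.log ((N n : ℝ) / ((n : ℝ) + 1)))) atTop (𝓝 (f x)) :=
    (hf.tendsto x).comp hlog
  refine le_of_tendsto' hfx fun n ↦ ?_
  have key := h (n + 1) (N n) n.succ_pos (hNpos n)
  have hN0 : (N n : ℝ) ≠ 0 := by exact_mod_cast (hNpos n).ne'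
  rw [Nat.cast_add, Nat.cast_one, ← Real.log_div hN0 (hn1 n).ne'] at key
  exact key

/-- From bounds on the dense set `log ℚ_{>0}` to all of `ℝ`: if `Φ` is a Weil test and
`0 ≤ Re Q(Φ + c·Φ(· − (log m₂ − log m₁)))` for all positive naturals `m₁, m₂` and all `c`, then
`‖B_Φ(x)‖ ≤ Re Q(Φ)` for every real `x`. [folklore] -/
theorem combShapeDetection_norm_expSum_le_of_nodes {Φ : ℝ → ℂ} (hΦ : IsWeilTest Φ)
    (hD : ∀ m₁ m₂ : ℕ, 0 < m₁ → 0 < m₂ → ∀ c : ℂ,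
      0 ≤ (weilQuadratic (translateMix Φ c (Real.log m₂ - Real.log m₁))).re) (x : ℝ) :
    ‖expSum Φ x‖ ≤ (zeroForm Φ).re := by
  have hQ : 0 ≤ (zeroForm Φ).re := by
    have h := hD 1 1 one_pos one_pos 0
    have e : translateMix Φ 0 (Real.log ((1 : ℕ) : ℝ) - Real.log ((1 : ℕ) : ℝ)) = Φ := by
      funext t
      simp [translateMix]
    rw [e, ← combShapeDetection_zeroForm_eq_weilQuadratic hΦ] at h
    exact h
  refine combShapeDetection_le_of_forall_log_nat_sub (f := fun y ↦ ‖expSum Φ y‖)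
    (continuous_norm.comp (combShapeDetection_continuous_expSum hΦ)) (fun m₁ m₂ h₁ h₂ ↦ ?_) x
  refine combShapeDetection_norm_expSum_le_of_translateMix hΦ hQ fun c ↦ ?_
  rw [combShapeDetection_zeroForm_eq_weilQuadratic (isWeilTest_translateMix hΦ c _)]
  exact hD m₁ m₂ h₁ h₂ c

/-- No terms off the line: if `‖B_g(x)‖ ≤ Q` for all real `x` then `m(ρ₀) P_g(ρ₀) = 0` for every
non-trivial zero `ρ₀` with `Re ρ₀ ≠ 1/2` (`BoundedPowerSum.sum_fiber_eq_zero_of_exp_real` with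
exponents `ρ − 1/2`, locally finite; the fibre over `ρ₀ − 1/2` is `{ρ₀}`; as in
`WeilConverse.order_mul_pairCoeff_eq_zero`). [folklore] -/
theorem combShapeDetection_order_mul_pairCoeff_eq_zero {g : ℝ → ℂ} (hg : IsWeilTest g) {Q : ℝ}
    (hB : ∀ x : ℝ, ‖expSum g x‖ ≤ Q) {ρ₀ : ℂ}
    (hρ₀ : ρ₀ ∈ ZetaZeros.riemannZetaNontrivialZeros) (hre : ρ₀.re ≠ 1 / 2) :
    (riemannZetaZeroOrder ρ₀ : ℂ) * pairCoeff g ρ₀ = 0 := by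
  have h := Literature.Analysis.Complex.BoundedPowerSum.sum_fiber_eq_zero_of_exp_real
    (ι := ZetaZeros.riemannZetaNontrivialZeros)
    (c := fun ρ ↦ (riemannZetaZeroOrder (ρ : ℂ) : ℂ) * pairCoeff g ρ)
    (lam := fun ρ ↦ (ρ : ℂ) - 1 / 2) (R := 1 / 2) (M := Q)
    (summable_norm_pairCoeff hg) (fun ρ ↦ abs_re_sub_half_le ρ.2) (fun z ↦ ?_)
    (fun x ↦ hB x) (μ := ρ₀ - 1 / 2) (by simpa [sub_re] using sub_ne_zero.2 hre)
    {⟨ρ₀, hρ₀⟩} (fun ρ ↦ ?_)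
  · simpa using h
  · refine ⟨1, one_pos, ?_⟩
    refine ((riemannZetaNontrivialZeros_finite_inter_ball (z + 1 / 2) 1).preimage
      (Subtype.val_injective.injOn)).subset fun ρ hρ ↦ ?_
    simp only [mem_setOf_eq, Metric.mem_ball, dist_eq_norm] at hρ
    refine ⟨ρ.2, ?_⟩
    rw [Metric.mem_ball, dist_eq_norm]
    rwa [show (ρ : ℂ) - (z + 1 / 2) = (ρ : ℂ) - 1 / 2 - z by ring]
  · rw [Finset.mem_singleton, sub_left_inj]
    constructor
    · rintro rfl; rfl
    · intro h; exact Subtype.ext h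

/-! ## The fixed bump `φ_ε(t) = ε⁻¹ expNegInvGlue (1 − (t/ε)²)` -/

/-- `φ_ε` is a Weil test (it is the one-node comb `M = 1`, `a = 1` of
`weilComb_shapeComb_isWeilTest`). [folklore] -/
theorem combShapeDetection_shapeBump_isWeilTest (ε : ℝ) :
    IsWeilTest (fun t : ℝ ↦ ((ε : ℝ) : ℂ)⁻¹ * ((expNegInvGlue (1 - (t / ε) ^ 2) : ℝ) : ℂ)) := by
  have h := weilComb_shapeComb_isWeilTest ε 1 (fun _ ↦ 1)
  have e : (fun x : ℝ => ∑ m ∈ Finset.Icc 1 (1 : ℕ), (fun _ : ℕ ↦ (1 : ℂ)) m *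
      (((ε : ℝ) : ℂ)⁻¹ * ((expNegInvGlue (1 - ((x - Real.log (m : ℝ)) / (ε : ℝ)) ^ 2) : ℝ) : ℂ))) =
      fun t : ℝ ↦ ((ε : ℝ) : ℂ)⁻¹ * ((expNegInvGlue (1 - (t / ε) ^ 2) : ℝ) : ℂ) := by
    funext x
    simp
  rw [e] at h
  exact h

/-- Non-vanishing on a horizontal line: if `0 < ε` and `ε|γ| ≤ 1` then
`Re φ̂_ε(σ + iγ) = ∫ φ_ε(t) e^{(σ − 1/2)t} cos(γt) dt > 0` for every real `σ` (the integrand is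
`≥ 0`, since `|γt| ≤ 1 < π/2` on the support `|t| ≤ ε`, and positive at `t = 0`; the argument of
`exists_isWeilTest_re_weilMellin_pos` for this particular bump). [folklore] -/
theorem combShapeDetection_re_weilMellin_shapeBump_pos {ε γ : ℝ} (hε : 0 < ε) (hεγ : ε * |γ| ≤ 1)
    (σ : ℝ) :
    0 < (weilMellin (fun t : ℝ ↦ ((ε : ℝ) : ℂ)⁻¹ * ((expNegInvGlue (1 - (t / ε) ^ 2) : ℝ) : ℂ))
      (σ + γ * I)).re := by
  set b : ℝ → ℝ := fun t ↦ ε⁻¹ * expNegInvGlue (1 - (t / ε) ^ 2) with hb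
  have hfun : (fun t : ℝ ↦ ((ε : ℝ) : ℂ)⁻¹ * ((expNegInvGlue (1 - (t / ε) ^ 2) : ℝ) : ℂ)) =
      fun t ↦ ((b t : ℝ) : ℂ) := by
    funext t
    simp only [hb]
    push_cast
    ring
  have hbc : Continuous b :=
    continuous_const.mul ((expNegInvGlue.contDiff (n := 0)).continuous.comp (by fun_prop))
  have hb0 : ∀ t, ε ≤ |t| → b t = 0 := fun t ht ↦ by
    have h1 : ε ^ 2 ≤ t ^ 2 := (pow_le_pow_left₀ hε.le ht 2).trans_eq (sq_abs t)
    have h2 : 1 ≤ (t / ε) ^ 2 := by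
      rw [div_pow, le_div_iff₀ (by positivity), one_mul]
      exact h1
    simp only [hb]
    rw [expNegInvGlue.zero_of_nonpos (by linarith), mul_zero]
  have hbsupp : HasCompactSupport b := by
    refine HasCompactSupport.intro (isCompact_Icc (a := -ε) (b := ε)) fun t ht ↦ hb0 t ?_
    simp only [mem_Icc, not_and_or, not_le] at ht
    rcases ht with h | h
    · exact le_abs.2 (Or.inr (by linarith))
    · exact le_abs.2 (Or.inl h.le)
  have hbnn : ∀ t, 0 ≤ b t := fun t ↦ mul_nonneg (inv_nonneg.2 hε.le) (expNegInvGlue.nonneg _)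
  have hb00 : b 0 ≠ 0 := by
    have h1 : 0 < expNegInvGlue (1 - (0 / ε) ^ 2) :=
      expNegInvGlue.pos_of_pos (by rw [zero_div, zero_pow two_ne_zero, sub_zero]; exact one_pos)
    exact (mul_pos (inv_pos.2 hε) h1).ne'
  rw [hfun]
  -- the integrand has real part `b(t) e^{(σ-1/2)t} cos(γ t) ≥ 0`, positive at `t = 0`
  set F : ℝ → ℝ := fun t ↦ b t * Real.exp ((σ - 1 / 2) * t) * Real.cos (γ * t) with hF
  have hint : Integrable fun t : ℝ ↦ ((b t : ℝ) : ℂ) * cexp ((σ + γ * I - 1 / 2) * t) :=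
    integrable_weilIntegrand (Complex.continuous_ofReal.comp hbc)
      (hbsupp.comp_left Complex.ofReal_zero) _
  have hre : ∀ t : ℝ, (((b t : ℝ) : ℂ) * cexp ((σ + γ * I - 1 / 2) * t)).re = F t := by
    intro t
    rw [Complex.re_ofReal_mul, Complex.exp_re]
    have h1 : ((σ + γ * I - 1 / 2) * (t : ℂ)).re = (σ - 1 / 2) * t := by
      simp [sub_re, add_re, mul_re]
    have h2 : ((σ + γ * I - 1 / 2) * (t : ℂ)).im = γ * t := by
      simp [sub_im, add_im, mul_im]
    rw [h1, h2, hF]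
    ring
  unfold weilMellin
  have hI := integral_re hint
  simp only [RCLike.re_to_complex] at hI
  beta_reduce
  rw [← hI]
  simp_rw [hre]
  have hFc : Continuous F := by
    simp only [hF]
    fun_prop
  have hFsupp : HasCompactSupport F := by
    simp only [hF]
    exact (hbsupp.mul_right).mul_right
  have hFnn : 0 ≤ F := by
    intro t
    simp only [hF, Pi.zero_apply]
    by_cases ht : |t| < ε
    · refine mul_nonneg (mul_nonneg (hbnn t) (Real.exp_pos _).le) (Real.cos_nonneg_of_mem_Icc ?_)
      have hγt : |γ * t| ≤ 1 := by
        rw [abs_mul]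
        calc |γ| * |t| ≤ |γ| * ε := mul_le_mul_of_nonneg_left ht.le (abs_nonneg _)
          _ = ε * |γ| := mul_comm _ _
          _ ≤ 1 := hεγ
      constructor <;> nlinarith [abs_le.1 hγt, Real.pi_gt_three]
    · have hbt : b t = 0 := hb0 t (not_lt.1 ht)
      simp [hbt]
  have hF0 : F 0 ≠ 0 := by
    simp only [hF, mul_zero, Real.exp_zero, Real.cos_zero, mul_one]
    exact hb00
  exact hFc.integral_pos_of_hasCompactSupport_nonneg_nonzero hFsupp hFnn hF0

/-! ## Two-node combs and the detection theorem -/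

/-- Two-node combs: under `CombShapePositivity`, for `ε > 0`, positive naturals `m₁, m₂` and
`c : ℂ`, `0 ≤ Re Q(φ_ε + c·φ_ε(· − (log m₂ − log m₁)))`.  The comb with coefficients
`a = 1_{m₁} + c·1_{m₂}` at level `max m₁ m₂` is the translate by `log m₁` of this test, and
`Q` is translation invariant (`weilQuadratic_translate`). [folklore] -/
theorem combShapeDetection_two_node_nonneg (hPos : CombShapePositivity) {ε : ℝ} (hε : 0 < ε)
    {m₁ m₂ : ℕ} (h₁ : 0 < m₁) (h₂ : 0 < m₂) (c : ℂ) :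
    0 ≤ (weilQuadratic (translateMix
      (fun t : ℝ ↦ ((ε : ℝ) : ℂ)⁻¹ * ((expNegInvGlue (1 - (t / ε) ^ 2) : ℝ) : ℂ)) c
      (Real.log m₂ - Real.log m₁))).re := by
  set Φ : ℝ → ℂ := fun t : ℝ ↦ ((ε : ℝ) : ℂ)⁻¹ * ((expNegInvGlue (1 - (t / ε) ^ 2) : ℝ) : ℂ)
  set M : ℕ := max m₁ m₂
  set a : ℕ → ℂ := fun m ↦ (if m = m₁ then 1 else 0) + (if m = m₂ then c else 0) with ha
  have hm₁ : m₁ ∈ Finset.Icc 1 M := Finset.mem_Icc.2 ⟨h₁, le_max_left _ _⟩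
  have hm₂ : m₂ ∈ Finset.Icc 1 M := Finset.mem_Icc.2 ⟨h₂, le_max_right _ _⟩
  have key := hPos ε hε M a
  have e : (fun x : ℝ => ∑ m ∈ Finset.Icc 1 M, a m * ((ε : ℂ)⁻¹ *
      ((expNegInvGlue (1 - ((x - Real.log (m : ℝ)) / ε) ^ 2) : ℝ) : ℂ))) =
      fun t ↦ translateMix Φ c (Real.log m₂ - Real.log m₁) (t + -Real.log m₁) := by
    funext x
    have hsum : ∑ m ∈ Finset.Icc 1 M, a m * Φ (x - Real.log m) =
        Φ (x - Real.log m₁) + c * Φ (x - Real.log m₂) := by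
      simp only [ha, add_mul, Finset.sum_add_distrib, ite_mul, one_mul, zero_mul,
        Finset.sum_ite_eq', hm₁, hm₂, if_true]
    show ∑ m ∈ Finset.Icc 1 M, a m * Φ (x - Real.log m) = _
    rw [hsum, show x + -Real.log m₁ = x - Real.log m₁ by ring]
    simp only [translateMix, Pi.add_apply, weilTranslate]
    rw [show x - Real.log m₁ - (Real.log m₂ - Real.log m₁) = x - Real.log m₂ by ring]
  rw [e, weilQuadratic_translate (translateMix Φ c (Real.log m₂ - Real.log m₁)) (-Real.log m₁)]
    at key
  exact key

/-- **Detection of off-line zeros by fixed-shape combs.** Under `CombShapePositivity` every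
non-trivial zero `ρ` of `ζ` has `Re ρ = 1/2`: with `ε = 1/(1 + |Im ρ|)` the bump `φ_ε` has
`‖B_{φ_ε}(x)‖ ≤ Re Q(φ_ε)` on `ℝ` (two-node combs, polarisation, density), hence
`m(ρ) P_{φ_ε}(ρ) = 0` if `Re ρ ≠ 1/2`; but `Re φ̂_ε > 0` on the horizontal line through `ρ` and
`1 − ρ̄`, so `P_{φ_ε}(ρ) ≠ 0`, and `m(ρ) ≥ 1`. [cite: Bombieri2000, §3 Thm 1] -/
theorem combShapeDetection_re_eq_one_half (hPos : CombShapePositivity) {ρ : ℂ}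
    (hρ : ρ ∈ ZetaZeros.riemannZetaNontrivialZeros) : ρ.re = 1 / 2 := by
  by_contra hre
  set ε : ℝ := 1 / (1 + |ρ.im|) with hε
  have hεpos : 0 < ε := by rw [hε]; positivity
  have hεγ : ε * |ρ.im| ≤ 1 := by
    rw [hε, one_div, inv_mul_le_iff₀ (by positivity : (0 : ℝ) < 1 + |ρ.im|)]
    linarith [abs_nonneg ρ.im]
  set Φ : ℝ → ℂ := fun t : ℝ ↦ ((ε : ℝ) : ℂ)⁻¹ * ((expNegInvGlue (1 - (t / ε) ^ 2) : ℝ) : ℂ)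
    with hΦ
  have hΦt : IsWeilTest Φ := combShapeDetection_shapeBump_isWeilTest ε
  have hD : ∀ m₁ m₂ : ℕ, 0 < m₁ → 0 < m₂ → ∀ c : ℂ,
      0 ≤ (weilQuadratic (translateMix Φ c (Real.log m₂ - Real.log m₁))).re :=
    fun m₁ m₂ h₁ h₂ c ↦ combShapeDetection_two_node_nonneg hPos hεpos h₁ h₂ c
  have hB := combShapeDetection_norm_expSum_le_of_nodes hΦt hD
  have h := combShapeDetection_order_mul_pairCoeff_eq_zero hΦt hB hρ hre
  have hpos : ∀ σ : ℝ, 0 < (weilMellin Φ (σ + ρ.im * I)).re := fun σ ↦ by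
    rw [hΦ]
    exact combShapeDetection_re_weilMellin_shapeBump_pos hεpos hεγ σ
  have hm : (riemannZetaZeroOrder ρ : ℂ) ≠ 0 := by
    have := ZetaZeros.riemannZetaNontrivialZeros.one_le_order hρ
    exact_mod_cast (by omega : riemannZetaZeroOrder ρ ≠ 0)
  have h1 : weilMellin Φ ρ ≠ 0 := by
    intro h0
    have := hpos ρ.re
    rw [show (ρ.re : ℂ) + ρ.im * I = ρ from Complex.re_add_im ρ, h0, Complex.zero_re] at this
    exact lt_irrefl _ this
  have h2 : weilMellin Φ (1 - conj ρ) ≠ 0 := by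
    intro h0
    have := hpos (1 - ρ.re)
    rw [show ((1 - ρ.re : ℝ) : ℂ) + ρ.im * I = 1 - conj ρ from ?_, h0, Complex.zero_re] at this
    · exact lt_irrefl _ this
    · apply Complex.ext <;> simp
  exact (mul_ne_zero hm (mul_ne_zero h1 ((map_ne_zero _).2 h2))) h

/-- **`CombShapeDetection` (item stmt-RiemannHypothesis-11230).** Fixed-shape comb positivity
implies uniform Weil positivity `∀ a > 0, WeilPositivityOn a`: by
`combShapeDetection_re_eq_one_half` every zero of `ζ` in the open critical strip lies on the
critical line, which is `RiemannHypothesis` (`riemannHypothesis_iff_strip_holds`), and RH is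
equivalent to uniform Weil positivity (`riemannHypothesis_iff_forall_weilPositivityOn`, Weil's
criterion in Yoshida's form, proved in tree). [cite: Bombieri2000, §3 Thm 1] -/
theorem combShapeDetection_proof : CombShapeDetection := by
  unfold CombShapeDetection
  intro hPos
  exact riemannHypothesis_iff_forall_weilPositivityOn.mp
    (riemannHypothesis_iff_strip_holds.2 fun ρ hs h0 h1 ↦
      combShapeDetection_re_eq_one_half hPos
        (ZetaZeros.riemannZetaNontrivialZeros.mem_iff'.2 ⟨hs, h0, h1⟩))

end Summit.RiemannHypothesis.RiemannHypothesis.Theorems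

end
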